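import Summits.QuantumFields.YangMills.Theorems.FluctuationComparisonRegPrIntLS2BetaRelativeKeyLemmaSkeleton
import HarnessLib

/-!
# S2β · letter (D♮)∕(D-stage) REL-TEL, the (C)-half — THE RELATIVE KEY LEMMA TOWER WITH SHARP WEIGHTS
# `‖f_t‖₂ ≤ exp(Σ_{i<t}(θ_i + ε_i∕√L))·((√L)^t·‖f_0‖₂ + Σ_{s<t} (√L)^{t−1−s}·η_s)` (px12 g24 ‼ 13:12:09Z (i): the source of level `s` is carried
# with ITS OWN weight `(√L)^{t−1−s}`, not the lossy `(√L)^t` of ✓p823396 `relKeyLemma_tower_sqrtL`)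

Cell `ym3-torus` (rung R3 = continuum `SU(2)` Yang–Mills on the three-torus — NOT d = 4, NOT infinite volume, NOT a mass gap, NOT Clay).
Width seat «width 10» `ym3-torus-px10` (gen 23), FREE px helper on crux `stmt-QuantumFields-20520`, count-neutral, DEFINITION-FREE; own-risk brick of the px10 lane
«(C)-half of letter (D♮)» (UV3-NODE §82).  Pure real-sequence bookkeeping: the exact unrolling of `x_{t+1} ≤ a_t·x_t + η_t` (`0 ≤ a_t`) is
`x_t ≤ (Π_{i<t} a_i)·x_0 + Σ_{s<t} (Π_{s<i<t} a_i)·η_s`; with `a_i = (1+θ_i)√L + ε_i ≤ √L·exp(θ_i + ε_i∕√L)` each tail product is `≤ (√L)^{t−1−s}·exp(Σ_{i<t}(…))`.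
This is the weight px12 g24's (H♭♭) row `C·(√L)^j·S + Σ_{u≤j} W j u·B_u` (✓∕⧗`dockRel_of_towers_feedback`) expects from the (C)-side discharger: `W j u ∝ (√L)^{j−1−u}·(η_u∕B_u)`.
* `le_prod_mul_add_sum_sharp_upto` ∕ `le_prod_mul_add_sum_sharp` — the exact unrolling, guarded (`t < m` hypotheses, `t ≤ m` conclusion) ∕ plain (induction;
  `Finset.prod_Ico_succ_top`).
* `prod_Ico_le_sqrtL_pow_mul_exp` — `Π_{i ∈ Ico (s+1) t}((1+θ_i)√(R_iC_i) + ε_i) ≤ (√L)^{t−1−s}·exp(Σ_{i<t}(θ_i + ε_i∕√L))` (`R_iC_i = L ≥ 1`, `θ, ε ≥ 0` below `t`, `s < t`).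
* ★★★ `relKeyLemma_tower_upto_sharp` — the GUARDED tower (levels `t < m`, conclusion for `t ≤ m`, one depth-`m` constant `exp(Σ_{i<m}(…))`; the shape the T³ record
  supplies, cf. ✓`keyLemma_tower_upto_sqrtL`) and ★★★ `relKeyLemma_tower_sharp` (all levels; hypotheses = ✓`relKeyLemma_tower_sqrtL`'s verbatim).

HONEST SCOPE.  Elementary real analysis over ✓p823396; nothing of Bałaban's asserted; the instantiation on the T³ record, the suppliers of `η_s` (✓∕⧗`relHstep_hj_bkg`:
`η_s ∝ (BKG_s + supRel_s)·‖dev_s‖₂`), (H♭♭), (D-stage), GAP♯∘ (`stub_uniformFibreGapOrbit`), S2β, crux 20520 and `YM3TorusSU2` are NOT proved; no registered stub is closed;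
the Yang–Mills mass gap is NOT proved.  Sorry-free, axioms standard.
References: T. Bałaban, CMP **99** (1985) 75–102 [Balaban1985RegularSpaces] (Lemma 1 p.79, Thm 2 (1.36)–(1.39) p.83); CMP **98** (1985) 17–51 [Balaban1985Averaging] ((19) p.21).
-/

set_option autoImplicit false

noncomputable section

namespace Summit.QuantumFields.YangMills.Theorems.FluctuationComparisonRegPrIntLS2BetaRelativeKeyLemmaSharpTower

open Finset
open scoped BigOperators
open Summit.QuantumFields.YangMills.Theorems.FluctuationComparisonRegPrIntLS2BetaRelativeKeyLemmaSkeleton (relKeyLemma_level)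

/-- **EXACT UNROLLING, GUARDED** (`x_{t+1} ≤ a_t·x_t + η_t` and `0 ≤ a_t` for `t < m` only): for every `t ≤ m`,
`x_t ≤ (Π_{i<t} a_i)·x_0 + Σ_{s<t} (Π_{i ∈ Ico (s+1) t} a_i)·η_s`. [folklore] -/
theorem le_prod_mul_add_sum_sharp_upto (x a η : ℕ → ℝ) (m : ℕ) (ha : ∀ t, t < m → 0 ≤ a t) (hrec : ∀ t, t < m → x (t + 1) ≤ a t * x t + η t) :
    ∀ t : ℕ, t ≤ m → x t ≤ (∏ i ∈ range t, a i) * x 0 + ∑ s ∈ range t, (∏ i ∈ Ico (s + 1) t, a i) * η s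
  | 0 => fun _ => by simp
  | t + 1 => fun ht => by
    have ht' : t < m := Nat.lt_of_succ_le ht
    have ih := le_prod_mul_add_sum_sharp_upto x a η m ha hrec t ht'.le
    have h1 := mul_le_mul_of_nonneg_left ih (ha t ht')
    have hsum : a t * ∑ s ∈ range t, (∏ i ∈ Ico (s + 1) t, a i) * η s = ∑ s ∈ range t, (∏ i ∈ Ico (s + 1) (t + 1), a i) * η s := by
      rw [Finset.mul_sum]
      refine Finset.sum_congr rfl fun s hs => ?_
      rw [Finset.prod_Ico_succ_top (Nat.succ_le_of_lt (Finset.mem_range.mp hs))]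
      ring
    have e : a t * ((∏ i ∈ range t, a i) * x 0 + ∑ s ∈ range t, (∏ i ∈ Ico (s + 1) t, a i) * η s) + η t =
        (∏ i ∈ range t, a i) * a t * x 0 + (∑ s ∈ range t, (∏ i ∈ Ico (s + 1) (t + 1), a i) * η s + η t) := by
      rw [mul_add, hsum]; ring
    rw [Finset.prod_range_succ, Finset.sum_range_succ, Finset.Ico_self, Finset.prod_empty, one_mul, ← e]
    exact (hrec t ht').trans (by linarith only [h1])

/-- **EXACT UNROLLING** of `x_{t+1} ≤ a_t·x_t + η_t` with `0 ≤ a_t` (all `t`): `x_t ≤ (Π_{i<t} a_i)·x_0 + Σ_{s<t} (Π_{i ∈ Ico (s+1) t} a_i)·η_s`. [folklore] -/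
theorem le_prod_mul_add_sum_sharp (x a η : ℕ → ℝ) (ha : ∀ t, 0 ≤ a t) (hrec : ∀ t, x (t + 1) ≤ a t * x t + η t) (t : ℕ) :
    x t ≤ (∏ i ∈ range t, a i) * x 0 + ∑ s ∈ range t, (∏ i ∈ Ico (s + 1) t, a i) * η s :=
  le_prod_mul_add_sum_sharp_upto x a η t (fun i _ => ha i) (fun i _ => hrec i) t le_rfl

/-- **TAIL PRODUCTS IN THE `√L` READING**: with `R_i·C_i = L ≥ 1`, `0 ≤ θ_i`, `0 ≤ ε_i` for `i < t`, and `s < t`,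
`Π_{i ∈ Ico (s+1) t}((1+θ_i)√(R_iC_i) + ε_i) ≤ (√L)^{t−1−s}·exp(Σ_{i<t}(θ_i + ε_i∕√L))`. [folklore] -/
theorem prod_Ico_le_sqrtL_pow_mul_exp {L : ℝ} (hL : 1 ≤ L) (R C θ ε : ℕ → ℝ) {s t : ℕ} (hRC : ∀ i, i < t → R i * C i = L) (hθ : ∀ i, i < t → 0 ≤ θ i)
    (hε : ∀ i, i < t → 0 ≤ ε i) (hst : s < t) :
    ∏ i ∈ Ico (s + 1) t, ((1 + θ i) * √(R i * C i) + ε i) ≤ Real.sqrt L ^ (t - 1 - s) * Real.exp (∑ i ∈ range t, (θ i + ε i / Real.sqrt L)) := by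
  have hsL : 1 ≤ Real.sqrt L := by rw [← Real.sqrt_one]; exact Real.sqrt_le_sqrt hL
  have hsL0 : 0 < Real.sqrt L := by linarith
  have hIco : ∀ i ∈ Ico (s + 1) t, i < t := fun i hi => (Finset.mem_Ico.mp hi).2
  have hfac : ∀ i ∈ Ico (s + 1) t, (1 + θ i) * √(R i * C i) + ε i ≤ Real.sqrt L * Real.exp (θ i + ε i / Real.sqrt L) := fun i hi => by
    rw [hRC i (hIco i hi)]
    have e : (1 + θ i) * Real.sqrt L + ε i = Real.sqrt L * (1 + (θ i + ε i / Real.sqrt L)) := by field_simp; ring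
    rw [e]
    exact mul_le_mul_of_nonneg_left (by linarith [Real.add_one_le_exp (θ i + ε i / Real.sqrt L)]) hsL0.le
  have hfac0 : ∀ i ∈ Ico (s + 1) t, 0 ≤ (1 + θ i) * √(R i * C i) + ε i := fun i hi => by
    have := hθ i (hIco i hi); have := hε i (hIco i hi); positivity
  have hcard : (Ico (s + 1) t).card = t - 1 - s := by rw [Nat.card_Ico]; omega
  have hsub : Ico (s + 1) t ⊆ range t := fun i hi => Finset.mem_range.mpr (hIco i hi)
  have hg0 : ∀ i ∈ range t, i ∉ Ico (s + 1) t → 0 ≤ θ i + ε i / Real.sqrt L := fun i hi _ => by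
    have hi' := Finset.mem_range.mp hi
    exact add_nonneg (hθ i hi') (div_nonneg (hε i hi') hsL0.le)
  calc ∏ i ∈ Ico (s + 1) t, ((1 + θ i) * √(R i * C i) + ε i) ≤ ∏ i ∈ Ico (s + 1) t, (Real.sqrt L * Real.exp (θ i + ε i / Real.sqrt L)) :=
        Finset.prod_le_prod hfac0 hfac
    _ = Real.sqrt L ^ (t - 1 - s) * Real.exp (∑ i ∈ Ico (s + 1) t, (θ i + ε i / Real.sqrt L)) := by
        rw [Finset.prod_mul_distrib, Finset.prod_const, hcard, Real.exp_sum]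
    _ ≤ Real.sqrt L ^ (t - 1 - s) * Real.exp (∑ i ∈ range t, (θ i + ε i / Real.sqrt L)) :=
        mul_le_mul_of_nonneg_left (Real.exp_le_exp.mpr (Finset.sum_le_sum_of_subset_of_nonneg hsub hg0)) (pow_nonneg hsL0.le _)

/-- ★★★ **THE RELATIVE KEY LEMMA TOWER, SHARP WEIGHTS, GUARDED** (every level hypothesis for `t < m` ONLY — the shape a finite history `t = 0, …, m = K − J`
supplies; cf. ✓`keyLemma_tower_upto_sqrtL`): if `R_i·C_i = L ≥ 1` then for every `t ≤ m`
`√Σ(f t)² ≤ exp(Σ_{i<m}(θ_i + ε_i∕√L))·((√L)^t·√Σ(f 0)² + Σ_{s<t} (√L)^{t−1−s}·η_s)` — ONE depth-`m` constant, the level-`s` source discounted by exactly the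
`t − 1 − s` averaging steps above it. [cite: Balaban1985RegularSpaces, Thm 2 (1.36)-(1.39) p.83] -/
theorem relKeyLemma_tower_upto_sharp (α : ℕ → Type*) [∀ t, Fintype (α t)] (m : ℕ) (f : (t : ℕ) → α t → ℝ) (hf : ∀ t a, 0 ≤ f t a)
    (K : (t : ℕ) → α (t + 1) → α t → ℝ) (hK : ∀ t, t < m → ∀ a b, 0 ≤ K t a b) {L : ℝ} (hL : 1 ≤ L) (R C θ ε η : ℕ → ℝ)
    (hR : ∀ t, t < m → 0 ≤ R t) (hRC : ∀ t, t < m → R t * C t = L)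
    (hrow : ∀ t, t < m → ∀ a, ∑ b, K t a b ≤ R t) (hcol : ∀ t, t < m → ∀ b, ∑ a, K t a b ≤ C t)
    (hθ : ∀ t, t < m → 0 ≤ θ t) (hε : ∀ t, t < m → 0 ≤ ε t) (hη : ∀ t, t < m → 0 ≤ η t)
    (j : (t : ℕ) → α (t + 1) → ℝ)
    (hstep : ∀ t, t < m → ∀ a, f (t + 1) a ≤ (1 + θ t) * ∑ b, K t a b * f t b + j t a)
    (hj : ∀ t, t < m → √(∑ a, j t a ^ 2) ≤ ε t * √(∑ b, f t b ^ 2) + η t) :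
    ∀ t, t ≤ m → √(∑ a, f t a ^ 2) ≤ Real.exp (∑ i ∈ range m, (θ i + ε i / Real.sqrt L)) *
      (Real.sqrt L ^ t * √(∑ b, f 0 b ^ 2) + ∑ s ∈ range t, Real.sqrt L ^ (t - 1 - s) * η s) := by
  intro t ht
  have hsL : 1 ≤ Real.sqrt L := by rw [← Real.sqrt_one]; exact Real.sqrt_le_sqrt hL
  have hsL0 : 0 < Real.sqrt L := by linarith
  set A : ℕ → ℝ := fun i => (1 + θ i) * √(R i * C i) + ε i with hA
  have hA0 : ∀ i, i < m → 0 ≤ A i := fun i hi => by have := hθ i hi; have := hε i hi; simp only [hA]; positivity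
  set G : ℝ := Real.exp (∑ i ∈ range m, (θ i + ε i / Real.sqrt L)) with hG
  -- the exact unrolling up to `t ≤ m`
  have h := le_prod_mul_add_sum_sharp_upto (fun t => √(∑ a, f t a ^ 2)) A η m hA0
    (fun i hi => relKeyLemma_level (K i) (hK i hi) (hR i hi) (hrow i hi) (hcol i hi) (f i) (f (i + 1)) (j i) (hf (i + 1)) (hθ i hi) (hstep i hi) (hj i hi)) t ht
  -- `Σ_{i<t} ≤ Σ_{i<m}` (nonnegative terms)
  have hsum : ∑ i ∈ range t, (θ i + ε i / Real.sqrt L) ≤ ∑ i ∈ range m, (θ i + ε i / Real.sqrt L) :=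
    Finset.sum_le_sum_of_subset_of_nonneg (Finset.range_subset_range.mpr ht) fun i hi _ => by
      have him : i < m := Finset.mem_range.mp hi
      exact add_nonneg (hθ i him) (div_nonneg (hε i him) hsL0.le)
  have hGt : Real.exp (∑ i ∈ range t, (θ i + ε i / Real.sqrt L)) ≤ G := Real.exp_le_exp.mpr hsum
  -- the head product: `Π_{i<t} A i ≤ (√L)^t·G`
  have hfac : ∀ i ∈ range t, A i ≤ Real.sqrt L * Real.exp (θ i + ε i / Real.sqrt L) := fun i hi => by
    simp only [hA]; rw [hRC i (lt_of_lt_of_le (Finset.mem_range.mp hi) ht)]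
    have e : (1 + θ i) * Real.sqrt L + ε i = Real.sqrt L * (1 + (θ i + ε i / Real.sqrt L)) := by field_simp; ring
    rw [e]
    exact mul_le_mul_of_nonneg_left (by linarith [Real.add_one_le_exp (θ i + ε i / Real.sqrt L)]) hsL0.le
  have hhead : ∏ i ∈ range t, A i ≤ Real.sqrt L ^ t * G := by
    calc ∏ i ∈ range t, A i ≤ ∏ i ∈ range t, (Real.sqrt L * Real.exp (θ i + ε i / Real.sqrt L)) :=
          Finset.prod_le_prod (fun i hi => hA0 i (lt_of_lt_of_le (Finset.mem_range.mp hi) ht)) hfac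
      _ = Real.sqrt L ^ t * Real.exp (∑ i ∈ range t, (θ i + ε i / Real.sqrt L)) := by
          rw [Finset.prod_mul_distrib, Finset.prod_const, Finset.card_range, Real.exp_sum]
      _ ≤ Real.sqrt L ^ t * G := mul_le_mul_of_nonneg_left hGt (pow_nonneg hsL0.le _)
  -- the tail products
  have htail : ∀ s ∈ range t, (∏ i ∈ Ico (s + 1) t, A i) * η s ≤ G * (Real.sqrt L ^ (t - 1 - s) * η s) := fun s hs => by
    have hs' := Finset.mem_range.mp hs
    have hp := prod_Ico_le_sqrtL_pow_mul_exp hL R C θ ε (fun i hi => hRC i (lt_of_lt_of_le hi ht)) (fun i hi => hθ i (lt_of_lt_of_le hi ht))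
      (fun i hi => hε i (lt_of_lt_of_le hi ht)) hs'
    have hη' := hη s (lt_of_lt_of_le hs' ht)
    calc (∏ i ∈ Ico (s + 1) t, A i) * η s ≤ Real.sqrt L ^ (t - 1 - s) * Real.exp (∑ i ∈ range t, (θ i + ε i / Real.sqrt L)) * η s :=
          mul_le_mul_of_nonneg_right hp hη'
      _ ≤ Real.sqrt L ^ (t - 1 - s) * G * η s := mul_le_mul_of_nonneg_right (mul_le_mul_of_nonneg_left hGt (pow_nonneg hsL0.le _)) hη'
      _ = G * (Real.sqrt L ^ (t - 1 - s) * η s) := by ring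
  have hf0 : 0 ≤ √(∑ b, f 0 b ^ 2) := Real.sqrt_nonneg _
  calc √(∑ a, f t a ^ 2) ≤ (∏ i ∈ range t, A i) * √(∑ b, f 0 b ^ 2) + ∑ s ∈ range t, (∏ i ∈ Ico (s + 1) t, A i) * η s := h
    _ ≤ Real.sqrt L ^ t * G * √(∑ b, f 0 b ^ 2) + ∑ s ∈ range t, G * (Real.sqrt L ^ (t - 1 - s) * η s) :=
        add_le_add (mul_le_mul_of_nonneg_right hhead hf0) (Finset.sum_le_sum htail)
    _ = G * (Real.sqrt L ^ t * √(∑ b, f 0 b ^ 2) + ∑ s ∈ range t, Real.sqrt L ^ (t - 1 - s) * η s) := by rw [← Finset.mul_sum]; ring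

/-- ★★★ **THE RELATIVE KEY LEMMA TOWER, SHARP WEIGHTS** (hypotheses = ✓`relKeyLemma_tower_sqrtL`'s, all levels): if `R_i·C_i = L ≥ 1` at every level then
`√Σ(f t)² ≤ exp(Σ_{i<t}(θ_i + ε_i∕√L))·((√L)^t·√Σ(f 0)² + Σ_{s<t} (√L)^{t−1−s}·η_s)`. [cite: Balaban1985RegularSpaces, Thm 2 (1.36)-(1.39) p.83] -/
theorem relKeyLemma_tower_sharp (α : ℕ → Type*) [∀ t, Fintype (α t)] (f : (t : ℕ) → α t → ℝ) (hf : ∀ t a, 0 ≤ f t a)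
    (K : (t : ℕ) → α (t + 1) → α t → ℝ) (hK : ∀ t a b, 0 ≤ K t a b) {L : ℝ} (hL : 1 ≤ L) (R C θ ε η : ℕ → ℝ) (hR : ∀ t, 0 ≤ R t)
    (hRC : ∀ t, R t * C t = L)
    (hrow : ∀ t a, ∑ b, K t a b ≤ R t) (hcol : ∀ t b, ∑ a, K t a b ≤ C t) (hθ : ∀ t, 0 ≤ θ t) (hε : ∀ t, 0 ≤ ε t) (hη : ∀ t, 0 ≤ η t)
    (j : (t : ℕ) → α (t + 1) → ℝ)
    (hstep : ∀ t a, f (t + 1) a ≤ (1 + θ t) * ∑ b, K t a b * f t b + j t a)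
    (hj : ∀ t, √(∑ a, j t a ^ 2) ≤ ε t * √(∑ b, f t b ^ 2) + η t) (t : ℕ) :
    √(∑ a, f t a ^ 2) ≤ Real.exp (∑ i ∈ range t, (θ i + ε i / Real.sqrt L)) *
      (Real.sqrt L ^ t * √(∑ b, f 0 b ^ 2) + ∑ s ∈ range t, Real.sqrt L ^ (t - 1 - s) * η s) :=
  relKeyLemma_tower_upto_sharp α t f hf K (fun i _ => hK i) hL R C θ ε η (fun i _ => hR i) (fun i _ => hRC i) (fun i _ => hrow i) (fun i _ => hcol i)
    (fun i _ => hθ i) (fun i _ => hε i) (fun i _ => hη i) j (fun i _ => hstep i) (fun i _ => hj i) t le_rfl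

end Summit.QuantumFields.YangMills.Theorems.FluctuationComparisonRegPrIntLS2BetaRelativeKeyLemmaSharpTower

end
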